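import Summits.AtomisticToContinuum.Crystallization.Theorems.ThreeConeCertificateSlackRigidityLawSelection
import Summits.AtomisticToContinuum.Crystallization.Theorems.ThreeConeCertificateSlackRigidityLawGoodMeasurable
import Summits.AtomisticToContinuum.Crystallization.Theorems.ThreeConeCertificateSlackRigidityLawPadding
import Summits.AtomisticToContinuum.Crystallization.Theorems.ThreeConeCertificateSlackRigidityLawCongruence
import Literature.MathematicalPhysics.StatisticalMechanics.HardCoreGSC
import HarnessLib

/-!
# `SlackRigidity` (stmt-AtomisticToContinuum-11960) implies RIGIDITY OF MINIMISING POINT-STATIONARY LAWS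

Closing file of lead c14's law-rigidity programme for the crux `ThreeConeCertificate.SlackRigidity`
(line `ekeland-surgery-parity`): the measure-level CONVERSE of the line.

* `ae_good_of_rigidFor` — if `P₀` witnesses the crux (`RigidFor P₀`), then for every `δ > 0`, every
  point-stationary probability law `P` on configurations of `ℝ³` that is a.s. rooted `δ`-hard-core and
  MINIMISING (`E_P[h] ≤ e* = ⨅_Q e(Q)`), and all `R, ε > 0`: `P`-a.s. the root is `(R, ε)`-good,
  `∃ A, LocallyMatches R ε (atoms μ) (A '' P₀.points)`.
  Proof: a measurable version `G` of the good event (`exists_measurableSet_good`); if `P(Gᶜ) ≠ 0` the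
  selection theorem (`exists_badCluster`: random-grid mass transport of energy AND badness, item 9229's
  machinery) yields finite clusters of unbounded size with `o(n)` excess and bad fraction `≥ b > 0`,
  which padded with ground states contradict `RigidFor P₀` (`not_rigidFor_of_badClusters`).
* `lawRigidity_of_slackRigidity` (registered stub) — the packaged necessary condition: the frame of item
  9224 `PalmRigidity` WITHOUT the hcp identification, conclusion "a.s. `(R, ε)`-good root" for all `R, ε`.
* `rootLawRigidity_of_slackRigidity` (registered stub) — `SlackRigidity ⇒ RootLawRigidityLe`, the
  hypothesis of `EkelandRootLawReduction.slackRigidity_of_rootLawRigidity` (p124681, lead c6) VERBATIM.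
  Together: **`SlackRigidity ⟺ RootLawRigidityLe`** — the crux IS the classification of minimising
  GSC-supported / arbitrary point-stationary hard-core laws as locally-one-template; c6's unfiled weaker
  residual is not weaker.  (The `↔` cannot be ONE Lean declaration today: this module is on the
  `Literature…MuGSC` side through `…EnergyFloor`, c6's on the `…MuGroundStateConfiguration` side, and
  the two Literature files declare the same FQNs — crux NOTES.md § Import hazard.)
* `lawCongruence_of_slackRigidity` (registered stub, HEADLINE) — `SlackRigidity ⇒` every minimising
  point-stationary rooted hard-core law is a.s. the counting measure's atoms of a ROTATION OF ONE
  PERIODIC CONFIGURATION: `atoms μ = A '' P₀.points` (`eq_image_of_forall_locallyMatches`).  Item 9224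
  `PalmRigidity` = this ∧ "the template is relaxed hcp with `(a, h) ∈ [1/2, 2]²`, `e(hcp a h) = e*`".
All `[folklore]`.
-/

noncomputable section

open scoped BigOperators Topology
open MeasureTheory Filter Set
open Literature.Probability.Process
open Literature.MathematicalPhysics.StatisticalMechanics
open Summit.AtomisticToContinuum.Crystallization.Theses.ThreeConeCertificate (SlackRigidity)

namespace Summit.AtomisticToContinuum.Crystallization.Theorems.SlackRigidityLawRigidity

open Summit.AtomisticToContinuum.Crystallization.Theorems.SlackRigidityNegative (E3 RigidFor slackRigidity_iff)
open Summit.AtomisticToContinuum.Crystallization.Theorems.ChargedEnergyGapNegative (crysEnergyLimit)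

/-- **A witness of the crux makes every minimising point-stationary hard-core law a.s. good at the
root**, at every `(R, ε)`. [folklore] -/
theorem ae_good_of_rigidFor {P₀ : PeriodicConfiguration 3} (hP₀ : RigidFor P₀) {δ : ℝ} (hδ : 0 < δ)
    (P : Measure (Measure E3)) [IsProbabilityMeasure P] (hcore : ∀ᵐ μ ∂P, IsRootedHardCore δ μ)
    (hstat : IsPointStationaryLaw P)
    (hE : (∫ μ, rootEnergy lennardJones μ ∂P) ≤
      (⨅ Q : PeriodicConfiguration 3, Q.energyPerParticle lennardJones))
    {R ε : ℝ} (hR : 0 < R) (hε : 0 < ε) :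
    ∀ᵐ μ ∂P, ∃ A : E3 →ₗᵢ[ℝ] E3, LocallyMatches R ε (atoms μ) (A '' P₀.points) := by
  obtain ⟨G, hGm, hG⟩ := SlackRigidityLawGoodMeasurable.exists_measurableSet_good P₀ R ε δ hε hδ
  by_cases hbad : P Gᶜ = 0
  · have hG' : ∀ᵐ μ ∂P, μ ∈ G := by
      rw [ae_iff]
      exact hbad
    filter_upwards [hG', hcore] with μ hμG hμ
    exact (hG μ hμ).1 hμG
  · exfalso
    obtain ⟨b, hb, hsup⟩ :=
      SlackRigidityLawSelection.exists_badCluster (P₀ := P₀) (R := R) (ε := ε) hδ P hcore hstat hE hGm hG hbad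
    exact SlackRigidityLawPadding.not_rigidFor_of_badClusters P₀ R ε b hR hε hb hsup hP₀

/-- **Registered stub `lawRigidity_of_slackRigidity`**: `SlackRigidity ⇒` every point-stationary rooted
`δ`-hard-core probability law with `E_P[h] ≤ ⨅_Q e(Q)` has, for all `R, ε > 0`, almost surely an
`(R, ε)`-good root with respect to ONE periodic template `P₀` (the crux witness). [folklore] -/
theorem lawRigidity_of_slackRigidity : SlackRigidity → ∃ P₀ : PeriodicConfiguration 3, ∀ δ : ℝ, 0 < δ → ∀ P : Measure (Measure E3), IsProbabilityMeasure P → (∀ᵐ μ ∂P, IsRootedHardCore δ μ) → IsPointStationaryLaw P → (∫ μ, rootEnergy lennardJones μ ∂P) ≤ (⨅ Q : PeriodicConfiguration 3, Q.energyPerParticle lennardJones) → ∀ R ε : ℝ, 0 < R → 0 < ε → ∀ᵐ μ ∂P, ∃ A : E3 →ₗᵢ[ℝ] E3, LocallyMatches R ε (atoms μ) (A '' P₀.points) := by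
  intro h
  obtain ⟨P₀, hP₀⟩ := slackRigidity_iff.1 h
  exact ⟨P₀, fun δ hδ P hP hcore hstat hE R ε hR hε => ae_good_of_rigidFor hP₀ hδ P hcore hstat hE hR hε⟩

/-- **Registered stub `rootLawRigidity_of_slackRigidity`**: `SlackRigidity ⇒ RootLawRigidityLe` — the
hypothesis of `EkelandRootLawReduction.slackRigidity_of_rootLawRigidity` (lead c6, p124681) verbatim
(the thermodynamic limit `e = lim E(N)/N` is `⨅_Q e(Q)` by `crysEnergyLimit`; the GSC-support hypothesis
is not needed).  With c6's theorem: `SlackRigidity ⟺ RootLawRigidityLe`. [folklore] -/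
theorem rootLawRigidity_of_slackRigidity : SlackRigidity → ∃ P₀ : PeriodicConfiguration 3, ∀ e : ℝ, Tendsto (fun N : ℕ => groundStateEnergy lennardJones 3 N / (N : ℝ)) atTop (𝓝 e) → ∀ δ : ℝ, 0 < δ → ∀ P : Measure (Measure E3), IsProbabilityMeasure P → (∀ᵐ μ ∂P, IsRootedHardCore δ μ) → IsPointStationaryLaw P → (∀ᵐ μ ∂P, IsHardCoreGSC lennardJones (atoms μ)) → (∫ μ, rootEnergy lennardJones μ ∂P) ≤ e → ∀ R ε : ℝ, 0 < R → 0 < ε → ∀ᵐ μ ∂P, ∃ A : E3 →ₗᵢ[ℝ] E3, LocallyMatches R ε (atoms μ) (A '' P₀.points) := by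
  intro h
  obtain ⟨P₀, hP₀⟩ := lawRigidity_of_slackRigidity h
  refine ⟨P₀, fun e he δ hδ P hP hcore hstat _ hE R ε hR hε => ?_⟩
  have heq : e = ⨅ Q : PeriodicConfiguration 3, Q.energyPerParticle lennardJones :=
    tendsto_nhds_unique he crysEnergyLimit
  exact hP₀ δ hδ P hP hcore hstat (heq ▸ hE) R ε hR hε

/-- **Registered stub `lawCongruence_of_slackRigidity` (headline)**: `SlackRigidity ⇒` every
point-stationary rooted `δ`-hard-core probability law with `E_P[h] ≤ ⨅_Q e(Q)` is almost surely carried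
by a ROTATION OF ONE PERIODIC CONFIGURATION: `atoms μ = A '' P₀.points` for a linear isometry `A`
(intersect the a.s. matchings over `(R, ε) = (n+1, 1/(n+1))` and upgrade by
`eq_image_of_forall_locallyMatches`).  This is item 9224 `PalmRigidity` minus the identification of the
template as the optimal relaxed hcp. [folklore] -/
theorem lawCongruence_of_slackRigidity : SlackRigidity → ∃ P₀ : PeriodicConfiguration 3, ∀ δ : ℝ, 0 < δ → ∀ P : Measure (Measure E3), IsProbabilityMeasure P → (∀ᵐ μ ∂P, IsRootedHardCore δ μ) → IsPointStationaryLaw P → (∫ μ, rootEnergy lennardJones μ ∂P) ≤ (⨅ Q : PeriodicConfiguration 3, Q.energyPerParticle lennardJones) → ∀ᵐ μ ∂P, ∃ A : E3 →ₗᵢ[ℝ] E3, atoms μ = A '' P₀.points := by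
  intro h
  obtain ⟨P₀, hP₀⟩ := lawRigidity_of_slackRigidity h
  refine ⟨P₀, fun δ hδ P hP hcore hstat hE => ?_⟩
  have hall : ∀ᵐ μ ∂P, ∀ n : ℕ, ∃ A : E3 →ₗᵢ[ℝ] E3,
      LocallyMatches ((n : ℝ) + 1) (1 / ((n : ℝ) + 1)) (atoms μ) (A '' P₀.points) :=
    ae_all_iff.2 fun n => hP₀ δ hδ P hP hcore hstat hE _ _ (by positivity) (by positivity)
  filter_upwards [hall, hcore] with μ hμ hhc
  obtain ⟨S, h0, hsep, rfl⟩ := hhc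
  rw [atoms_count_restrict] at hμ ⊢
  refine SlackRigidityLawCongruence.eq_image_of_forall_locallyMatches P₀ S δ hδ hsep fun R ε hR hε => ?_
  obtain ⟨n, hn⟩ := exists_nat_ge (max R (1 / ε))
  obtain ⟨A, hA⟩ := hμ n
  refine ⟨A, hA.mono ?_ ?_⟩
  · exact (le_max_left _ _).trans (hn.trans (by linarith))
  · have h1 : 1 / ε ≤ (n : ℝ) + 1 := (le_max_right _ _).trans (hn.trans (by linarith))
    rw [div_le_iff₀ hε] at h1
    rw [div_le_iff₀ (by positivity)]
    linarith

end Summit.AtomisticToContinuum.Crystallization.Theorems.SlackRigidityLawRigidity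

end
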